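import Mathlib
import HarnessLib
import Summits.HubbardSuperconductivity.HubbardSuperconductivity.Theorems.KLProgrammeKLRegimeSectorSliceRows

/-!
# Route `KLProgramme` — engine support (route (L2), FIRST MOMENT): the WEIGHTED row and column sums of the sectorised counterterm slice
# covariance `Sᵀ(F)·C^K_{(Λ,Λ′]}·S(F)` reduce to WEIGHTED `ℓ¹` norms of ONE product-torus character sum per sector pair

Cell `gate-hubbard-kl`, seat p3 (g9), for the ENGINE child stmt-HubbardSuperconductivity-20437 (`stub_engine_step_norms`, WEIGHTED lines `j ≥ 1`; located
risk «(b)-Wt@j≥1»; memo HOME/p3/g9/WT-DECAY-SCALES.md).  The weighted determinant-bounded steps (`GrassmannWeightedEffectiveAction…`) read the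
covariance through `hrow`/`hcol` hypotheses `Σ_{Y′} ‖C′ Y Y′‖·wt{Y, Y′} ≤ α_w` with a tree weight of the label PAIR; for the scale-`j` weight
`klScaleWt … j = 1 + Λ_j·d` the pair weight is a function `w(x − y)` of the space-time DIFFERENCE, even under `z ↦ −z`.  This file is the weighted
twin of k3c2-p3's `…SectorSliceRows` (NO analysis): for `C′ = Sᵀ(F)·C^K_{(Λ,Λ′]}·S(F)` on an admissible frame and ANY even weight `w` on the product
torus `(ℤ/2M)¹ × (ℤ/L)²`,

* **`rowSumWt_norm_pullback_sliceCT_le`**: `Σ_{Y′} ‖C′ Y Y′‖·w(x_Y − x_{Y′}) ≤ 8·Σ_{ω′} T_w(ω, ω′)`,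
* **`colSumWt_norm_pullback_sliceCT_le`**: `Σ_{Y} ‖C′ Y Y′‖·w(x_Y − x_{Y′}) ≤ 8·Σ_{ω} T_w(ω, ω′)`,

`T_w(ω,ω′) = Σ_z w(z)·‖Σ_q χ_{q₁}(z₁)χ_{q₂}(z₂) • G_{ωω′}(q)‖`, `G_{ωω′}(q) = (βL²)⁻²·F_ω(k_q)F_{ω′}(k_q)·Ψ̂_{ω(q₁)}(e_K(q₂))` (same symbol as the unweighted file;
`8 = 2 spins × 2 charges × 2 orientations`, the reversed orientation folded by the evenness of `w`).  With `w = 1 + s₀|z̃₁| + s₁|z̃₂|₁` the right-hand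
side is the left-hand side of `…SectorSliceCharSumMoment.sliceCharSumWt_l1_le_of_data` / `sum_wt_norm_charSum_le_of_third_differences`.
Everything is proved; no definitions, no named facts. [folklore]

References: G. Benfatto, A. Giuliani, V. Mastropietro, Ann. Henri Poincaré 7 (2006) 809–898, §2.7 (2.66)–(2.67), §2.8 (2.81) and footnote ¹, (3.3).
-/

noncomputable section

namespace Summit.HubbardSuperconductivity.HubbardSuperconductivity.Theorems.TorusFourierL2

set_option linter.dupNamespace false -- summit = problem name (single-conjunct summit), D-0017

open Finset Complex Literature.MathematicalPhysics.QuantumLattice Literature.Probability.LatticeModels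
open scoped Real

section Rows

variable {L M N : ℕ} [NeZero L] [NeZero M]

omit [NeZero L] [NeZero M] in
/-- The reversed difference is minus the difference: `((y₀ − x₀), y⃗ − x⃗) = (−(x₀ − y₀), −(x⃗ − y⃗))` on the product torus. [folklore] -/
theorem spaceTimeDiff_rev_eq_neg (x y : SpaceTimeIdx L M) :
    ((fun _ : Fin 1 => ((y.1 : ℕ) : ZMod (2 * M)) - ((x.1 : ℕ) : ZMod (2 * M))), y.2 - x.2) =
      (-(fun _ : Fin 1 => ((x.1 : ℕ) : ZMod (2 * M)) - ((y.1 : ℕ) : ZMod (2 * M))), -(x.2 - y.2)) := by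
  ext
  · simp
  · simp

/-- **Weighted row sums of the sectorised zero-seed CT slice covariance** reduce to one WEIGHTED character-sum `ℓ¹` norm per sector pair: for
every nonnegative even weight `w` on the product torus (`w(−z) = w(z)`) and every auxiliary label `Y = (x, ((ω,σ),c))`,
`Σ_{Y'} ‖(Sᵀ C^K_{(Λ,Λ′]} S) Y Y'‖·w(x − x') ≤ 8 · Σ_{ω′} Σ_z w(z)·‖Σ_q χ_{q₁}(z₁)χ_{q₂}(z₂) • G_{ωω′}(q)‖`,
`G_{ωω′}(q) = (βL²)⁻² F_ω(k_q) F_{ω′}(k_q) Ψ̂_{ω(q₁)}(e_K(q₂))`. [cite: BenfattoGiulianiMastropietro2006, §2.7 (2.66)–(2.67)] -/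
theorem rowSumWt_norm_pullback_sliceCT_le {β : ℝ} (hβ : β ≠ 0) (μ : ℝ) (K : TrigPolyC4v) (Λ Λ' : ℝ)
    (F : Fin N → FreqMomentum L M → ℂ) (w : TorusSite 1 (2 * M) × TorusSite 2 L → ℝ) (hw0 : ∀ z, 0 ≤ w z)
    (hw : ∀ a b, w (-a, -b) = w (a, b)) (Y : SpaceTimeIdx L M × SectorLeg N) :
    ∑ Y' : SpaceTimeIdx L M × SectorLeg N,
        ‖((sectorSubMatrix L M β F).transpose * hubbardCovSliceCT L M β μ 0 K Λ Λ' * sectorSubMatrix L M β F) Y Y'‖ *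
          w ((fun _ : Fin 1 => ((Y.1.1 : ℕ) : ZMod (2 * M)) - ((Y'.1.1 : ℕ) : ZMod (2 * M))), Y.1.2 - Y'.1.2) ≤
      8 * ∑ ω' : Fin N, ∑ z : TorusSite 1 (2 * M) × TorusSite 2 L, w z *
        ‖∑ q : TorusSite 1 (2 * M) × TorusSite 2 L, (torusChar q.1 z.1 * torusChar q.2 z.2) •
          ((((1 / (β * (L : ℝ) ^ 2) : ℝ) : ℂ) ^ 2 *
            (F Y.2.1.1 (⟨(q.1 0).val, ZMod.val_lt (q.1 0)⟩, q.2) * F ω' (⟨(q.1 0).val, ZMod.val_lt (q.1 0)⟩, q.2) *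
              sliceSymbolFnXi (β * (L : ℝ) ^ 2) 0 Λ Λ' (matsubaraFreq β M ⟨(q.1 0).val, ZMod.val_lt (q.1 0)⟩)
                (nambuXiCT L μ K q.2))))‖ := by
  classical
  rw [hubbardCovSliceCT_eq_normalCovariance_sliceSymbolFnXi hβ μ K Λ Λ']
  set p : FreqMomentum L M × Fin 2 → ℂ := fun ks =>
    sliceSymbolFnXi (β * (L : ℝ) ^ 2) 0 Λ Λ' (matsubaraFreq β M ks.1.1) (nambuXiCT L μ K ks.1.2) with hp
  -- the weighted per-pair character sum as a function on the product torus
  set T : Fin N → TorusSite 1 (2 * M) × TorusSite 2 L → ℝ := fun ω' z =>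
    ‖∑ q : TorusSite 1 (2 * M) × TorusSite 2 L, (torusChar q.1 z.1 * torusChar q.2 z.2) •
      ((((1 / (β * (L : ℝ) ^ 2) : ℝ) : ℂ) ^ 2 *
        (F Y.2.1.1 (⟨(q.1 0).val, ZMod.val_lt (q.1 0)⟩, q.2) * F ω' (⟨(q.1 0).val, ZMod.val_lt (q.1 0)⟩, q.2) *
          p ((⟨(q.1 0).val, ZMod.val_lt (q.1 0)⟩, q.2), Y.2.1.2))))‖ with hT
  -- split the sum over `Y' = (y, ℓ')`
  rw [Fintype.sum_prod_type_right]
  -- for each label `ℓ'`, the weighted `y`-sum is at most `2 Σ_z w z · T(ℓ'.ω, z)`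
  have hℓ : ∀ ℓ' : SectorLeg N, ∑ y : SpaceTimeIdx L M,
      ‖((sectorSubMatrix L M β F).transpose * normalCovariance L M p * sectorSubMatrix L M β F) Y (y, ℓ')‖ *
          w ((fun _ : Fin 1 => ((Y.1.1 : ℕ) : ZMod (2 * M)) - ((y.1 : ℕ) : ZMod (2 * M))), Y.1.2 - y.2) ≤
        2 * ∑ z : TorusSite 1 (2 * M) × TorusSite 2 L, w z * T ℓ'.1.1 z := by
    intro ℓ'
    calc ∑ y : SpaceTimeIdx L M,
          ‖((sectorSubMatrix L M β F).transpose * normalCovariance L M p * sectorSubMatrix L M β F) Y (y, ℓ')‖ *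
            w ((fun _ : Fin 1 => ((Y.1.1 : ℕ) : ZMod (2 * M)) - ((y.1 : ℕ) : ZMod (2 * M))), Y.1.2 - y.2)
        ≤ ∑ y : SpaceTimeIdx L M,
            ((fun z => w z * T ℓ'.1.1 z) ((fun _ : Fin 1 => ((Y.1.1 : ℕ) : ZMod (2 * M)) - ((y.1 : ℕ) : ZMod (2 * M))), Y.1.2 - y.2) +
              (fun z => w z * T ℓ'.1.1 z) ((fun _ : Fin 1 => ((y.1 : ℕ) : ZMod (2 * M)) - ((Y.1.1 : ℕ) : ZMod (2 * M))), y.2 - Y.1.2)) := by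
          refine Finset.sum_le_sum fun y _ => ?_
          have h := norm_pullback_normalCovariance_le hβ F p Y (y, ℓ')
          -- the weight at the reversed difference equals the weight at the difference
          have hwrev : w ((fun _ : Fin 1 => ((y.1 : ℕ) : ZMod (2 * M)) - ((Y.1.1 : ℕ) : ZMod (2 * M))), y.2 - Y.1.2) =
              w ((fun _ : Fin 1 => ((Y.1.1 : ℕ) : ZMod (2 * M)) - ((y.1 : ℕ) : ZMod (2 * M))), Y.1.2 - y.2) := by
            rw [spaceTimeDiff_rev_eq_neg Y.1 y, hw]
          dsimp only
          rw [hwrev]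
          have hmul := mul_le_mul_of_nonneg_right h (hw0 ((fun _ : Fin 1 => ((Y.1.1 : ℕ) : ZMod (2 * M)) - ((y.1 : ℕ) : ZMod (2 * M))), Y.1.2 - y.2))
          refine hmul.trans (le_of_eq ?_)
          simp only [hT]
          ring
      _ = ∑ z : TorusSite 1 (2 * M) × TorusSite 2 L, w z * T ℓ'.1.1 z + ∑ z : TorusSite 1 (2 * M) × TorusSite 2 L, w z * T ℓ'.1.1 z := by
          rw [Finset.sum_add_distrib, sum_spaceTime_eq_sum_prodTorus (fun z => w z * T ℓ'.1.1 z) Y.1,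
            sum_spaceTime_eq_sum_prodTorus_rev (fun z => w z * T ℓ'.1.1 z) Y.1]
      _ = 2 * ∑ z : TorusSite 1 (2 * M) × TorusSite 2 L, w z * T ℓ'.1.1 z := by ring
  -- sum over the labels: `ℓ' = ((ω',σ'),c')`, the bound depends on `ω'` only
  calc ∑ ℓ' : SectorLeg N, ∑ y : SpaceTimeIdx L M,
        ‖((sectorSubMatrix L M β F).transpose * normalCovariance L M p * sectorSubMatrix L M β F) Y (y, ℓ')‖ *
          w ((fun _ : Fin 1 => ((Y.1.1 : ℕ) : ZMod (2 * M)) - ((y.1 : ℕ) : ZMod (2 * M))), Y.1.2 - y.2)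
      ≤ ∑ ℓ' : SectorLeg N, 2 * ∑ z : TorusSite 1 (2 * M) × TorusSite 2 L, w z * T ℓ'.1.1 z := Finset.sum_le_sum fun ℓ' _ => hℓ ℓ'
    _ = ∑ ω' : Fin N, ∑ _σ' : Fin 2, ∑ _c' : Fin 2, 2 * ∑ z : TorusSite 1 (2 * M) × TorusSite 2 L, w z * T ω' z := by
        rw [Fintype.sum_prod_type, Fintype.sum_prod_type]
    _ = 8 * ∑ ω' : Fin N, ∑ z : TorusSite 1 (2 * M) × TorusSite 2 L, w z * T ω' z := by
        rw [Finset.mul_sum]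
        refine Finset.sum_congr rfl fun ω' _ => ?_
        simp only [Finset.sum_const, Finset.card_univ, Fintype.card_fin]
        ring
    _ = _ := by rw [hT]

/-- **Weighted column sums** of the sectorised zero-seed CT slice covariance: for every nonnegative even weight `w` and every
`Y' = (y, ((ω′,σ′),c′))`, `Σ_{Y} ‖(Sᵀ C^K_{(Λ,Λ′]} S) Y Y'‖·w(x − y) ≤ 8 · Σ_{ω} Σ_z w(z)·‖Σ_q χ_{q₁}(z₁)χ_{q₂}(z₂) • G_{ωω′}(q)‖` with the symbol
read at the spin `σ′` (it is spin-independent). [cite: BenfattoGiulianiMastropietro2006, §2.7 (2.66)–(2.67)] -/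
theorem colSumWt_norm_pullback_sliceCT_le {β : ℝ} (hβ : β ≠ 0) (μ : ℝ) (K : TrigPolyC4v) (Λ Λ' : ℝ)
    (F : Fin N → FreqMomentum L M → ℂ) (w : TorusSite 1 (2 * M) × TorusSite 2 L → ℝ) (hw0 : ∀ z, 0 ≤ w z)
    (hw : ∀ a b, w (-a, -b) = w (a, b)) (Y' : SpaceTimeIdx L M × SectorLeg N) :
    ∑ Y : SpaceTimeIdx L M × SectorLeg N,
        ‖((sectorSubMatrix L M β F).transpose * hubbardCovSliceCT L M β μ 0 K Λ Λ' * sectorSubMatrix L M β F) Y Y'‖ *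
          w ((fun _ : Fin 1 => ((Y.1.1 : ℕ) : ZMod (2 * M)) - ((Y'.1.1 : ℕ) : ZMod (2 * M))), Y.1.2 - Y'.1.2) ≤
      8 * ∑ ω : Fin N, ∑ z : TorusSite 1 (2 * M) × TorusSite 2 L, w z *
        ‖∑ q : TorusSite 1 (2 * M) × TorusSite 2 L, (torusChar q.1 z.1 * torusChar q.2 z.2) •
          ((((1 / (β * (L : ℝ) ^ 2) : ℝ) : ℂ) ^ 2 *
            (F ω (⟨(q.1 0).val, ZMod.val_lt (q.1 0)⟩, q.2) * F Y'.2.1.1 (⟨(q.1 0).val, ZMod.val_lt (q.1 0)⟩, q.2) *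
              sliceSymbolFnXi (β * (L : ℝ) ^ 2) 0 Λ Λ' (matsubaraFreq β M ⟨(q.1 0).val, ZMod.val_lt (q.1 0)⟩)
                (nambuXiCT L μ K q.2))))‖ := by
  classical
  rw [hubbardCovSliceCT_eq_normalCovariance_sliceSymbolFnXi hβ μ K Λ Λ']
  set p : FreqMomentum L M × Fin 2 → ℂ := fun ks =>
    sliceSymbolFnXi (β * (L : ℝ) ^ 2) 0 Λ Λ' (matsubaraFreq β M ks.1.1) (nambuXiCT L μ K ks.1.2) with hp
  set T : Fin N → TorusSite 1 (2 * M) × TorusSite 2 L → ℝ := fun ω z =>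
    ‖∑ q : TorusSite 1 (2 * M) × TorusSite 2 L, (torusChar q.1 z.1 * torusChar q.2 z.2) •
      ((((1 / (β * (L : ℝ) ^ 2) : ℝ) : ℂ) ^ 2 *
        (F ω (⟨(q.1 0).val, ZMod.val_lt (q.1 0)⟩, q.2) * F Y'.2.1.1 (⟨(q.1 0).val, ZMod.val_lt (q.1 0)⟩, q.2) *
          p ((⟨(q.1 0).val, ZMod.val_lt (q.1 0)⟩, q.2), Y'.2.1.2))))‖ with hT
  rw [Fintype.sum_prod_type_right]
  have hℓ : ∀ ℓ : SectorLeg N, ∑ x : SpaceTimeIdx L M,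
      ‖((sectorSubMatrix L M β F).transpose * normalCovariance L M p * sectorSubMatrix L M β F) (x, ℓ) Y'‖ *
          w ((fun _ : Fin 1 => ((x.1 : ℕ) : ZMod (2 * M)) - ((Y'.1.1 : ℕ) : ZMod (2 * M))), x.2 - Y'.1.2) ≤
        2 * ∑ z : TorusSite 1 (2 * M) × TorusSite 2 L, w z * T ℓ.1.1 z := by
    intro ℓ
    -- the symbol is spin-independent: read it at `σ'` instead of `σ`
    have hsym : ∀ (x : SpaceTimeIdx L M),
        ‖((sectorSubMatrix L M β F).transpose * normalCovariance L M p * sectorSubMatrix L M β F) (x, ℓ) Y'‖ ≤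
          T ℓ.1.1 ((fun _ : Fin 1 => ((x.1 : ℕ) : ZMod (2 * M)) - ((Y'.1.1 : ℕ) : ZMod (2 * M))), x.2 - Y'.1.2) +
            T ℓ.1.1 ((fun _ : Fin 1 => ((Y'.1.1 : ℕ) : ZMod (2 * M)) - ((x.1 : ℕ) : ZMod (2 * M))), Y'.1.2 - x.2) := by
      intro x
      have h := norm_pullback_normalCovariance_le hβ F p (x, ℓ) Y'
      have hpσ : ∀ k : FreqMomentum L M, p (k, ℓ.1.2) = p (k, Y'.2.1.2) := fun k => rfl
      simp only [hpσ] at h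
      exact h
    calc ∑ x : SpaceTimeIdx L M,
          ‖((sectorSubMatrix L M β F).transpose * normalCovariance L M p * sectorSubMatrix L M β F) (x, ℓ) Y'‖ *
            w ((fun _ : Fin 1 => ((x.1 : ℕ) : ZMod (2 * M)) - ((Y'.1.1 : ℕ) : ZMod (2 * M))), x.2 - Y'.1.2)
        ≤ ∑ x : SpaceTimeIdx L M,
            ((fun z => w z * T ℓ.1.1 z) ((fun _ : Fin 1 => ((x.1 : ℕ) : ZMod (2 * M)) - ((Y'.1.1 : ℕ) : ZMod (2 * M))), x.2 - Y'.1.2) +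
              (fun z => w z * T ℓ.1.1 z) ((fun _ : Fin 1 => ((Y'.1.1 : ℕ) : ZMod (2 * M)) - ((x.1 : ℕ) : ZMod (2 * M))), Y'.1.2 - x.2)) := by
          refine Finset.sum_le_sum fun x _ => ?_
          have hwrev : w ((fun _ : Fin 1 => ((x.1 : ℕ) : ZMod (2 * M)) - ((Y'.1.1 : ℕ) : ZMod (2 * M))), x.2 - Y'.1.2) =
              w ((fun _ : Fin 1 => ((Y'.1.1 : ℕ) : ZMod (2 * M)) - ((x.1 : ℕ) : ZMod (2 * M))), Y'.1.2 - x.2) := by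
            rw [spaceTimeDiff_rev_eq_neg Y'.1 x, hw]
          dsimp only
          have hmul := mul_le_mul_of_nonneg_right (hsym x)
            (hw0 ((fun _ : Fin 1 => ((x.1 : ℕ) : ZMod (2 * M)) - ((Y'.1.1 : ℕ) : ZMod (2 * M))), x.2 - Y'.1.2))
          rw [hwrev] at hmul ⊢
          refine hmul.trans (le_of_eq ?_)
          ring
      _ = ∑ z : TorusSite 1 (2 * M) × TorusSite 2 L, w z * T ℓ.1.1 z + ∑ z : TorusSite 1 (2 * M) × TorusSite 2 L, w z * T ℓ.1.1 z := by
          rw [Finset.sum_add_distrib, sum_spaceTime_eq_sum_prodTorus_rev (fun z => w z * T ℓ.1.1 z) Y'.1,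
            sum_spaceTime_eq_sum_prodTorus (fun z => w z * T ℓ.1.1 z) Y'.1]
      _ = 2 * ∑ z : TorusSite 1 (2 * M) × TorusSite 2 L, w z * T ℓ.1.1 z := by ring
  calc ∑ ℓ : SectorLeg N, ∑ x : SpaceTimeIdx L M,
        ‖((sectorSubMatrix L M β F).transpose * normalCovariance L M p * sectorSubMatrix L M β F) (x, ℓ) Y'‖ *
          w ((fun _ : Fin 1 => ((x.1 : ℕ) : ZMod (2 * M)) - ((Y'.1.1 : ℕ) : ZMod (2 * M))), x.2 - Y'.1.2)
      ≤ ∑ ℓ : SectorLeg N, 2 * ∑ z : TorusSite 1 (2 * M) × TorusSite 2 L, w z * T ℓ.1.1 z := Finset.sum_le_sum fun ℓ _ => hℓ ℓ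
    _ = ∑ ω : Fin N, ∑ _σ : Fin 2, ∑ _c : Fin 2, 2 * ∑ z : TorusSite 1 (2 * M) × TorusSite 2 L, w z * T ω z := by
        rw [Fintype.sum_prod_type, Fintype.sum_prod_type]
    _ = 8 * ∑ ω : Fin N, ∑ z : TorusSite 1 (2 * M) × TorusSite 2 L, w z * T ω z := by
        rw [Finset.mul_sum]
        refine Finset.sum_congr rfl fun ω _ => ?_
        simp only [Finset.sum_const, Finset.card_univ, Fintype.card_fin]
        ring
    _ = _ := by rw [hT]

end Rows

end Summit.HubbardSuperconductivity.HubbardSuperconductivity.Theorems.TorusFourierL2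

end
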